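import Summits.NavierStokesRegularity.NavierStokesRegularity.Theorems.TaoLadderRungTwoFlatHopTubeCanonical
import HarnessLib

/-!
# NUM-T53 / TRAP #8 — the REFERENCE-DEFECT / ANCHOR-FLOOR RACE: the negative direction of the clamped anchor algebra
  (cell harvest/h2-tao-ladder, theory-1 g41; helper next to `…Theorems.HopTube` part 3 (`…HopTubeCanonical`,
  p689869) for item stmt-NavierStokesRegularity-23909 `GradedAdiabaticWake` / the pending child `GradedAdiabaticWakeA`)

PROVENANCE (p1 g22): theory-1 g41's image of record numT53/AnchorRace53.lean sha16 f81af8c9c969bc2d (farm `lean check` rc 0 · 0 sorry · 0 warnings),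
landed with declarations BYTE-IDENTICAL (helper for the K_A♭ parent item stmt-NavierStokesRegularity-22987); the image's module
docstring follows verbatim.

`…HopTubeCanonical` proves the FORWARD bookkeeping of the clamped rule `a = max(f, s/A_*)`: an unclamped hop resets the
anchor deficit, a clamped hop adds at most the shortfall `max 0 (1 − R/f)` of the state's carrier ratio `R` against the
floor `f = (1+ε₀)^{−θ₀}` (`anchorDeficit_step_sharp`).  This file adds the CONVERSE direction, which is what makes the
steady-regime condition `R ≥ f` a genuine constraint on the tube's REFERENCE profile and not a matter of small `ε₀`:

* `anchorCoord_le_ratio_div_floor` — the re-centred anchor coordinate is AT MOST `x·R/f` whenever the landing carrier is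
  at most `A·x·R`: the clamped rule cannot do better than ratio-over-floor;
* `anchorCoord_step_of_shortfall` — a carrier shortfall by a fixed fraction below the floor, `s ≤ A·x·(1−κ)f`, forces
  `x′ ≤ (1−κ)·x`;
* `anchorCoord_geometric_decay`, `anchorBand_eventually_fails` — if that happens at every hop the anchor coordinate decays
  geometrically and EVERY band `A_*(1−Γ) ≤ |z i₀ 0|` with `Γ < 1` fails at some hop: a persistent per-hop shortfall kills
  `AnchorClause`, whatever the (ε₀-free) band schedule;
* `anchorDeficit_step_of_floor_le` — the positive twin in the form the schedule uses: `f ≤ R` ⇒ the deficit does not grow.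

WHY IT MATTERS (memo numT53/ANCHOR-RACE-53.md, floats numT53/anchor_race53.py): over a Core ball of gauge radius `δ_∞`
around the scaled reference the worst carrier ratio is `1 + r⋆ε₀ − C·δ_∞` to first order (`r⋆` the reference's own
first-order ratio offset, `C` the pickup constant of `AnchoredHopContraction`), and `δ_∞ ≥` the gauge distance from the
reference to the actual graded orbit.  For the ZEROTH-ORDER reference (the flat pulse) both are `O(ε₀)` with measured
coefficients `r⋆ = −0.49`, `c_∞ = 0.50`, `C = 1.35` (ω(4,2) gauge), i.e. a worst-case shortfall `≈ 1.17ε₀` (and `≥ 0.98ε₀`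
for ANY symmetric ball, from the mirror state of the orbit) against a floor allowance `θ₀ε₀ < ε₀/2`: `κ > 0` at EVERY hop
and every `ε₀` — the situation of `anchorBand_eventually_fails`.  A reference with hop defect `o(ε₀)·(1−ρ′)/C` (the
`J`-fold graded pre-iterate of the flat pulse, `J ≥ 4`, or the first-order corrected profile of LADDER 50.7 (C)) puts the
tube in the situation of `anchorDeficit_step_of_floor_le` instead (ruling R53-1).

HONEST FRAMING: MODEL lattice (graded mirror table on `S♭`, `m = 2`); elementary real algebra about the SHAPE of an
induction hypothesis; the coefficients quoted above are UNSEALED floats; nothing certified; nothing about the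
Navier–Stokes equations.
-/

noncomputable section

set_option linter.dupNamespace false

namespace Summit.NavierStokesRegularity.NavierStokesRegularity.Theorems.HopTube

/-! ## The converse of the clamped deficit step -/

section AnchorRace

/-- The clamped rule cannot beat ratio-over-floor: if the landing carrier is at most `A·x·R`, the re-centred anchor
coordinate `x′ = (s / clampRatio f s A) / A` is at most `x·R/f`. [folklore; cell LADDER §53] -/
theorem anchorCoord_le_ratio_div_floor {f s A x R : ℝ} (hf : 0 < f) (hA : 0 < A)
    (hs : s ≤ A * (x * R)) :
    s / clampRatio f s A / A ≤ x * R / f := by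
  rw [carrier_div_clampRatio_eq hf hA]
  have h1 : min (s / f) A / A ≤ s / f / A :=
    div_le_div_of_nonneg_right (min_le_left _ _) hA.le
  have h2 : s / f / A ≤ A * (x * R) / f / A :=
    div_le_div_of_nonneg_right (div_le_div_of_nonneg_right hs hf.le) hA.le
  have h3 : A * (x * R) / f / A = x * R / f := by
    field_simp
  linarith [h1, h2, h3.le, h3.ge]

/-- One hop under a carrier SHORTFALL by the fixed fraction `κ` below the floor, `s ≤ A·x·((1−κ)·f)`: the anchor
coordinate contracts, `x′ ≤ (1−κ)·x`. [folklore; cell LADDER §53] -/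
theorem anchorCoord_step_of_shortfall {f s A x κ : ℝ} (hf : 0 < f) (hA : 0 < A)
    (hs : s ≤ A * (x * ((1 - κ) * f))) :
    s / clampRatio f s A / A ≤ (1 - κ) * x := by
  have h := anchorCoord_le_ratio_div_floor hf hA hs
  have e : x * ((1 - κ) * f) / f = (1 - κ) * x := by
    field_simp
  linarith [h, e.le, e.ge]

/-- Geometric decay of the anchor coordinate under a persistent shortfall. [folklore] -/
theorem anchorCoord_geometric_decay {κ : ℝ} {x : ℕ → ℝ} (hκ1 : κ ≤ 1)
    (hstep : ∀ n, x (n + 1) ≤ (1 - κ) * x n) (n : ℕ) : x n ≤ (1 - κ) ^ n * x 0 := by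
  induction n with
  | zero => simp
  | succ n ih =>
    calc x (n + 1) ≤ (1 - κ) * x n := hstep n
      _ ≤ (1 - κ) * ((1 - κ) ^ n * x 0) := mul_le_mul_of_nonneg_left ih (by linarith)
      _ = (1 - κ) ^ (n + 1) * x 0 := by ring

/-- **A persistent per-hop shortfall kills every anchor band.** If at every hop the carrier falls short of the floor by
the fraction `κ > 0` (so `x (n+1) ≤ (1−κ)·x n` by `anchorCoord_step_of_shortfall`) and `x 0 ≤ 1`, then for every
`Γ < 1` some anchor coordinate drops below `1 − Γ`, i.e. the band `A_*(1−Γ) ≤ |z i₀ 0|` of `AnchorClause` fails —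
for ANY band schedule bounded by `Γ`, ε₀-free or not. [folklore; cell LADDER §53 (TRAP #8)] -/
theorem anchorBand_eventually_fails {κ Γ : ℝ} {x : ℕ → ℝ} (hκ : 0 < κ) (hκ1 : κ ≤ 1) (hΓ : Γ < 1)
    (hx1 : x 0 ≤ 1) (hstep : ∀ n, x (n + 1) ≤ (1 - κ) * x n) :
    ∃ n, x n < 1 - Γ := by
  obtain ⟨n, hn⟩ := exists_pow_lt_of_lt_one (show 0 < 1 - Γ by linarith) (show 1 - κ < 1 by linarith)
  refine ⟨n, ?_⟩
  calc x n ≤ (1 - κ) ^ n * x 0 := anchorCoord_geometric_decay hκ1 hstep n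
    _ ≤ (1 - κ) ^ n := mul_le_of_le_one_right (pow_nonneg (by linarith) n) hx1
    _ < 1 - Γ := hn

/-- The positive twin in schedule form: once the state's carrier ratio clears the floor, `f ≤ R`, the deficit does not
grow: `1 − x′ ≤ 1 − x`. (`anchorDeficit_step_sharp` with a vanishing shortfall term.) [folklore; cell LADDER §53] -/
theorem anchorDeficit_step_of_floor_le {f s A x R : ℝ} (hf : 0 < f) (hA : 0 < A) (hx0 : 0 ≤ x) (hx1 : x ≤ 1)
    (hs : A * (x * R) ≤ s) (hfR : f ≤ R) :
    1 - s / clampRatio f s A / A ≤ 1 - x := by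
  have h := anchorDeficit_step_sharp hf hA hx0 hx1 hs
  have h0 : max 0 (1 - R / f) = 0 := by
    apply max_eq_left
    have : 1 ≤ R / f := by rw [le_div_iff₀ hf]; linarith
    linarith
  linarith [h, h0.le, h0.ge]

end AnchorRace

end Summit.NavierStokesRegularity.NavierStokesRegularity.Theorems.HopTube
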